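import Summits.AtomisticToContinuum.HydrodynamicLimit.Theses.AntiMazurCoboundaries
import Literature.MathematicalPhysics.KineticTheory.HardSphereEulerProofs
import Literature.MathematicalPhysics.KineticTheory.HardBallErgodicity
import Literature.Analysis.FluidPDE.EmpiricalCollisionMeasure

/-!
# drefute gen 2 — the SANDWICH for `stub_fastSectorDominance` (line `kinetic-entropy-collision-budget`,
crux `AntiMazurCoboundaries.CorrectorPressureDecay`, stmt-AtomisticToContinuum-14135)

Refuter `refuter-drefute-stmt-AtomisticToContinuum-14135-g2-0`, 2026-08-16.

CLAIM (kernel-checked below, modulo the TRUE stub 2 `OneBodyEntropyBudget` taken as a hypothesis):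

  `OneBodyEntropyBudget → DiscreteWindowPressureDecay → FastSectorDominance`

where `DiscreteWindowPressureDecay` is the crux-frame statement "the discrete-window exponential moment
`∫ exp(2·A_n) dG_N` of every admissible fast observable of amplitude `≤ κ₂` is `≤ e^{η(N+1)}` for all windows
`H ≥ H₁(φ,g,η)`, all `N ≥ N₀`, every flow and all fine samplings `n ≥ n₀`" — i.e. the shared wall
`KineticFluxLdDecay` (stmt-10967) in the discrete-sampling form that stubs 1 and 6 of the line already live in
(10967 ⇒ it on paper: Hölder + invariance make `L ↦ L·log∫e^{Ā_L}` subadditive, so `∃τ` upgrades to `∀H ≥ H₁`;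
right-endpoint Riemann sums of the piecewise-continuous path `t ↦ F(Φ_t z)` converge on the good set, bounded
convergence gives all `n ≥ n₀(N,Φ)`).

MECHANISM OF THE PROOF (no kinetic theory, no collision record, no fast/slow splitting):
* Part A (abstract, any probability space): for a bounded measurable potential `V`,
  `KL(μ.tilted V ‖ μ) = E_{tilt}[V] − log∫e^V ≤ log∫e^{2V} + 2·log∫e^{−V}`
  (Jensen under the tilt with `Y = 2V`: `log∫e^V + E_{tilt}V ≤ log∫e^{2V}`; and `0 ≤ log∫e^{V} + log∫e^{−V}` by Jensen
  twice). So the ENTROPY of the window optimiser is bounded by two window PRESSURES (of `2g` and of `−g`).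
* Part B (one law on `𝕋³ × ℝ³`): `fastDev π ≤ condKL π` for every finite `π` — pointwise
  `(√r − 1)² ≤ r log r + 1 − r` (`= 2√r·klFun(√r) ≥ 0`), Tonelli, `klDiv = ∫ klFun(dπ/dref) dref`.
  The WHOLE Hellinger deviation (slow AND fast sector) is below the conditional entropy.
* Part C (crux frame): with stub 2, `(N+1)·fd(Π̄(Q)) ≤ (N+1)·condKL(Π̄(Q)) ≤ KL(Q‖G_N) ≤ η(N+1)`, which is the
  dominance inequality with `A = C = 0`.

CONSEQUENCE (logical position of stub 5, correcting the skeleton docstring "strictly stronger, by design: it is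
the mechanism … its failure alone would not refute the crux"): together with the skeleton's own sorry-free
composition (stubs 1,2,3,6 + FSD ⇒ X) and the route's ExponentialCertificate (X ⇒ 10967(κ/2)), and 10967 ⇒
`DiscreteWindowPressureDecay` (paper, above), stub 5 is EQUIVALENT to the crux X and to the wall 10967 as
`∃κ`-statements: `10967 ⇒ DWPD ⇒ FSD ⇒ X ⇒ 10967`. The fast-sector / Hellinger-split / collision-transport
apparatus of the line is logically idle: FSD carries exactly the content "the window optimiser has `o(1)` entropy per
particle", which is the pressure decay itself by convexity. No stub is false; stub 5 is the crux in costume.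

All theorems here are sorry-free. Defs of the skeleton are copied VERBATIM (same names) so that
`FastSectorDominance` below is the registered stub statement token for token.
-/

noncomputable section

open MeasureTheory ProbabilityTheory InformationTheory Set Filter Topology
open scoped ENNReal

namespace Summit.AtomisticToContinuum.HydrodynamicLimit.Cruxes.CorrectorPressureDecay.KineticEntropyCollisionBudget.Sandwich

open Literature.MathematicalPhysics.KineticTheory (T3 V3 hsDiameter localGibbsLaw)
open Literature.Analysis.FluidPDE (HardSphereFlow Config)

/-! ## Part A — entropy of an exponential tilt is bounded by two pressures (abstract) -/

section Abstract

variable {X : Type*} [MeasurableSpace X]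

/-- Bounded measurable real functions have integrable exponentials on a finite measure space.
(Copied from the standing disprover's `Disproof.lean`, section MazurFloor.) -/
theorem integrable_exp_of_abs_le {μ : Measure X} [IsFiniteMeasure μ] {V : X → ℝ} (hVm : Measurable V) {C : ℝ}
    (hV : ∀ x, |V x| ≤ C) : Integrable (fun x => Real.exp (V x)) μ := by
  refine (integrable_const (Real.exp C)).mono' (Real.continuous_exp.measurable.comp hVm).aestronglyMeasurable
    (ae_of_all _ fun x => ?_)
  rw [Real.norm_eq_abs, abs_of_pos (Real.exp_pos _)]
  exact Real.exp_le_exp.2 ((le_abs_self _).trans (hV x))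

/-- Bounded measurable real functions are integrable on a finite measure space. (Copied from `Disproof.lean`.) -/
theorem integrable_of_abs_le {μ : Measure X} [IsFiniteMeasure μ] {V : X → ℝ} (hVm : Measurable V) {C : ℝ}
    (hV : ∀ x, |V x| ≤ C) : Integrable V μ :=
  (integrable_const C).mono' hVm.aestronglyMeasurable (ae_of_all _ fun x => by simpa [Real.norm_eq_abs] using hV x)

/-- **Jensen under the tilted law** (copied verbatim from the standing disprover's `Disproof.lean` v6,
`tilted_jensen`): `(∫ e^V dμ) · exp(∫ (Y − V) d(μ.tilted V)) ≤ ∫ e^Y dμ`. -/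
theorem tilted_jensen {μ : Measure X} [IsProbabilityMeasure μ] {V Y : X → ℝ} (hVm : Measurable V)
    (hYm : Measurable Y) {CV CY : ℝ} (hV : ∀ x, |V x| ≤ CV) (hY : ∀ x, |Y x| ≤ CY) :
    (∫ x, Real.exp (V x) ∂μ) * Real.exp (∫ x, (Y x - V x) ∂(μ.tilted V)) ≤ ∫ x, Real.exp (Y x) ∂μ := by
  have hexpV : Integrable (fun x => Real.exp (V x)) μ := integrable_exp_of_abs_le hVm hV
  haveI : IsProbabilityMeasure (μ.tilted V) := isProbabilityMeasure_tilted hexpV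
  set Z : ℝ := ∫ x, Real.exp (V x) ∂μ with hZ
  have hZpos : 0 < Z := by
    rw [hZ]; exact integral_exp_pos hexpV
  have hD : ∀ x, |Y x - V x| ≤ CY + CV := fun x => (abs_sub _ _).trans (add_le_add (hY x) (hV x))
  have hDint : Integrable (fun x => Y x - V x) (μ.tilted V) := integrable_of_abs_le (hYm.sub hVm) hD
  have hexpDint : Integrable (fun x => Real.exp (Y x - V x)) (μ.tilted V) :=
    integrable_exp_of_abs_le (hYm.sub hVm) hD
  have hJ := ConvexOn.map_integral_le convexOn_exp Real.continuous_exp.continuousOn isClosed_univ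
    (ae_of_all _ fun x => mem_univ _) hDint hexpDint
  have hcomp : ∫ x, Real.exp (Y x - V x) ∂(μ.tilted V) = Z⁻¹ * ∫ x, Real.exp (Y x) ∂μ := by
    rw [integral_tilted]
    simp_rw [smul_eq_mul, ← hZ]
    rw [← integral_const_mul]
    refine integral_congr_ae (ae_of_all _ fun x => ?_)
    show Real.exp (V x) / Z * Real.exp (Y x - V x) = Z⁻¹ * Real.exp (Y x)
    rw [Real.exp_sub, div_eq_mul_inv, mul_comm (Real.exp (V x)) Z⁻¹, mul_assoc,
      mul_div_cancel₀ _ (Real.exp_pos _).ne']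
  rw [hcomp] at hJ
  have := mul_le_mul_of_nonneg_left hJ hZpos.le
  rwa [← mul_assoc, mul_inv_cancel₀ hZpos.ne', one_mul] at this

/-- Jensen: `exp(∫ V dμ) ≤ ∫ e^V dμ` for a bounded measurable `V` and a probability measure `μ`. -/
theorem exp_integral_le_integral_exp {μ : Measure X} [IsProbabilityMeasure μ] {V : X → ℝ} (hVm : Measurable V)
    {C : ℝ} (hV : ∀ x, |V x| ≤ C) : Real.exp (∫ x, V x ∂μ) ≤ ∫ x, Real.exp (V x) ∂μ := by
  have h := tilted_jensen (μ := μ) (V := fun _ => (0 : ℝ)) (Y := V) measurable_const hVm (CV := 0)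
    (fun _ => by simp) hV
  have htc : μ.tilted (fun _ => (0 : ℝ)) = μ := tilted_const μ 0
  simp only [Real.exp_zero, integral_const, probReal_univ, one_smul, sub_zero, htc, one_mul] at h
  exact h

/-- `0 ≤ log ∫ e^V dμ + log ∫ e^{−V} dμ` (product of the two Jensen inequalities: `1 = e^{E V}e^{−E V} ≤ Z₊ Z₋`). -/
theorem log_integral_exp_add_log_integral_exp_neg_nonneg {μ : Measure X} [IsProbabilityMeasure μ] {V : X → ℝ}
    (hVm : Measurable V) {C : ℝ} (hV : ∀ x, |V x| ≤ C) :
    0 ≤ Real.log (∫ x, Real.exp (V x) ∂μ) + Real.log (∫ x, Real.exp (-V x) ∂μ) := by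
  have hVn : ∀ x, |(-V x)| ≤ C := fun x => by rw [abs_neg]; exact hV x
  have h1 := exp_integral_le_integral_exp (μ := μ) hVm hV
  have hVnm : Measurable fun x => -V x := hVm.neg
  have h2 : Real.exp (∫ x, -V x ∂μ) ≤ ∫ x, Real.exp (-V x) ∂μ :=
    exp_integral_le_integral_exp (μ := μ) hVnm hVn
  have hZ1 : 0 < ∫ x, Real.exp (V x) ∂μ := integral_exp_pos (integrable_exp_of_abs_le hVm hV)
  have hZ2 : 0 < ∫ x, Real.exp (-V x) ∂μ := integral_exp_pos (integrable_exp_of_abs_le hVnm hVn)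
  rw [← Real.log_mul hZ1.ne' hZ2.ne']
  refine Real.log_nonneg ?_
  have hneg : ∫ x, -V x ∂μ = -∫ x, V x ∂μ := integral_neg V
  rw [hneg] at h2
  calc (1 : ℝ) = Real.exp (∫ x, V x ∂μ) * Real.exp (-∫ x, V x ∂μ) := by
        rw [← Real.exp_add, add_neg_cancel, Real.exp_zero]
    _ ≤ (∫ x, Real.exp (V x) ∂μ) * ∫ x, Real.exp (-V x) ∂μ :=
        mul_le_mul h1 h2 (Real.exp_pos _).le hZ1.le

/-- The log-likelihood ratio of a bounded tilt is a.e. the bounded function `V − log Z`. -/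
theorem llr_tilted_ae_eq {μ : Measure X} [IsProbabilityMeasure μ] {V : X → ℝ} (hVm : Measurable V) {C : ℝ}
    (hV : ∀ x, |V x| ≤ C) :
    llr (μ.tilted V) μ =ᵐ[μ.tilted V] fun x => V x - Real.log (∫ x, Real.exp (V x) ∂μ) := by
  have hexpV : Integrable (fun x => Real.exp (V x)) μ := integrable_exp_of_abs_le hVm hV
  have h := log_rnDeriv_tilted_left_self hexpV
  exact (tilted_absolutelyContinuous μ V).ae_le h

/-- KL of a bounded tilt is finite. -/
theorem klDiv_tilted_ne_top {μ : Measure X} [IsProbabilityMeasure μ] {V : X → ℝ} (hVm : Measurable V) {C : ℝ}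
    (hV : ∀ x, |V x| ≤ C) : klDiv (μ.tilted V) μ ≠ ∞ := by
  have hexpV : Integrable (fun x => Real.exp (V x)) μ := integrable_exp_of_abs_le hVm hV
  haveI : IsProbabilityMeasure (μ.tilted V) := isProbabilityMeasure_tilted hexpV
  refine klDiv_ne_top (tilted_absolutelyContinuous μ V) ?_
  refine (integrable_congr (llr_tilted_ae_eq hVm hV)).2 ?_
  exact (integrable_of_abs_le hVm hV).sub (integrable_const _)

/-- **Gibbs variational identity at the tilt**: `KL(μ.tilted V ‖ μ) = ∫ V d(μ.tilted V) − log ∫ e^V dμ`. -/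
theorem toReal_klDiv_tilted {μ : Measure X} [IsProbabilityMeasure μ] {V : X → ℝ} (hVm : Measurable V) {C : ℝ}
    (hV : ∀ x, |V x| ≤ C) :
    (klDiv (μ.tilted V) μ).toReal = (∫ x, V x ∂(μ.tilted V)) - Real.log (∫ x, Real.exp (V x) ∂μ) := by
  have hexpV : Integrable (fun x => Real.exp (V x)) μ := integrable_exp_of_abs_le hVm hV
  haveI : IsProbabilityMeasure (μ.tilted V) := isProbabilityMeasure_tilted hexpV
  rw [toReal_klDiv_of_measure_eq (tilted_absolutelyContinuous μ V) (by simp),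
    integral_congr_ae (llr_tilted_ae_eq hVm hV), integral_sub (integrable_of_abs_le hVm hV) (integrable_const _),
    integral_const, probReal_univ, one_smul]

/-- **MAIN ABSTRACT LEMMA (entropy ≤ two pressures).** For a probability measure `μ` and a bounded measurable
`V`: `KL(μ.tilted V ‖ μ) ≤ log ∫ e^{2V} dμ + 2 · log ∫ e^{−V} dμ`. Proof: `KL = E_{tilt}V − log Z₁`
(`toReal_klDiv_tilted`), `log Z₁ + E_{tilt}V ≤ log Z₂` (`tilted_jensen` with `Y = 2V`), and
`−2 log Z₁ ≤ 2 log Z₋₁` (`log_integral_exp_add_log_integral_exp_neg_nonneg`). -/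
theorem toReal_klDiv_tilted_le {μ : Measure X} [IsProbabilityMeasure μ] {V : X → ℝ} (hVm : Measurable V)
    {C : ℝ} (hV : ∀ x, |V x| ≤ C) :
    (klDiv (μ.tilted V) μ).toReal ≤
      Real.log (∫ x, Real.exp (2 * V x) ∂μ) + 2 * Real.log (∫ x, Real.exp (-V x) ∂μ) := by
  have hexpV : Integrable (fun x => Real.exp (V x)) μ := integrable_exp_of_abs_le hVm hV
  have hZ1 : 0 < ∫ x, Real.exp (V x) ∂μ := integral_exp_pos hexpV
  have h2V : ∀ x, |2 * V x| ≤ 2 * C := fun x => by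
    rw [abs_mul, abs_of_pos (by norm_num : (0 : ℝ) < 2)]
    exact mul_le_mul_of_nonneg_left (hV x) (by norm_num)
  have hJ := tilted_jensen (μ := μ) hVm (hVm.const_mul 2) hV h2V
  have hsub : (fun x => 2 * V x - V x) = V := by funext x; ring
  rw [hsub] at hJ
  -- take logarithms: `log Z₁ + E_{tilt} V ≤ log Z₂`
  have hpos : 0 < (∫ x, Real.exp (V x) ∂μ) * Real.exp (∫ x, V x ∂(μ.tilted V)) := mul_pos hZ1 (Real.exp_pos _)
  have hlog := Real.log_le_log hpos hJ
  rw [Real.log_mul hZ1.ne' (Real.exp_pos _).ne', Real.log_exp] at hlog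
  have h0 := log_integral_exp_add_log_integral_exp_neg_nonneg (μ := μ) hVm hV
  rw [toReal_klDiv_tilted hVm hV]
  linarith

/-- **Hölder + invariance** (link (i)(a) of the sandwich: the abstract core of "`L ↦ L·log∫e^{Ā_L}dG_N` is subadditive",
with `f = Ā_{L₁}`, `g = Ā_{L₂}`, `T = Φ_{L₁}`, `s = L₁/(L₁+L₂)` and the group property on the good set). For a probability measure `μ` preserved by `T`, bounded measurable `f, g` and `0 < s < 1`:
`∫ exp(s f + (1 − s) g∘T) dμ ≤ (∫ e^f dμ)^s (∫ e^g dμ)^{1−s}`. -/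
theorem integral_exp_convexComb_comp_le {X : Type*} [MeasurableSpace X] {μ : Measure X} [IsProbabilityMeasure μ]
    {T : X → X} (hT : MeasurePreserving T μ μ) {f g : X → ℝ} (hfm : Measurable f) (hgm : Measurable g)
    {Cf Cg : ℝ} (hf : ∀ x, |f x| ≤ Cf) (hg : ∀ x, |g x| ≤ Cg) {s : ℝ} (hs0 : 0 < s) (hs1 : s < 1) :
    ∫ x, Real.exp (s * f x + (1 - s) * g (T x)) ∂μ ≤
      (∫ x, Real.exp (f x) ∂μ) ^ s * (∫ x, Real.exp (g x) ∂μ) ^ (1 - s) := by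
  have hs1' : 0 < 1 - s := by linarith
  set F : X → ℝ := fun x => Real.exp (s * f x) with hFdef
  set G : X → ℝ := fun x => Real.exp ((1 - s) * g (T x)) with hGdef
  have hsum : ∀ x, Real.exp (s * f x + (1 - s) * g (T x)) = F x * G x := fun x => Real.exp_add _ _
  simp_rw [hsum]
  have hpq : (s⁻¹).HolderConjugate (1 - s)⁻¹ := Real.HolderConjugate.inv_one_sub_inv hs0 hs1
  have hFnn : 0 ≤ᵐ[μ] F := ae_of_all _ fun x => (Real.exp_pos _).le
  have hGnn : 0 ≤ᵐ[μ] G := ae_of_all _ fun x => (Real.exp_pos _).le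
  have hFm : AEStronglyMeasurable F μ :=
    (Real.continuous_exp.measurable.comp (hfm.const_mul s)).aestronglyMeasurable
  have hGm : AEStronglyMeasurable G μ :=
    (Real.continuous_exp.measurable.comp (((hgm.comp hT.measurable)).const_mul (1 - s))).aestronglyMeasurable
  have hF : MemLp F (ENNReal.ofReal s⁻¹) μ := by
    refine MemLp.of_bound hFm (Real.exp (s * Cf)) (ae_of_all _ fun x => ?_)
    rw [Real.norm_eq_abs, abs_of_pos (Real.exp_pos _)]
    exact Real.exp_le_exp.2 (mul_le_mul_of_nonneg_left ((le_abs_self _).trans (hf x)) hs0.le)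
  have hG : MemLp G (ENNReal.ofReal (1 - s)⁻¹) μ := by
    refine MemLp.of_bound hGm (Real.exp ((1 - s) * Cg)) (ae_of_all _ fun x => ?_)
    rw [Real.norm_eq_abs, abs_of_pos (Real.exp_pos _)]
    exact Real.exp_le_exp.2 (mul_le_mul_of_nonneg_left ((le_abs_self _).trans (hg (T x))) hs1'.le)
  have hH := integral_mul_le_Lp_mul_Lq_of_nonneg hpq hFnn hGnn hF hG
  have hF' : ∀ x, F x ^ s⁻¹ = Real.exp (f x) := fun x => by
    rw [hFdef, ← Real.exp_mul]
    congr 1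
    field_simp
  have hG' : ∀ x, G x ^ (1 - s)⁻¹ = Real.exp (g (T x)) := fun x => by
    rw [hGdef, ← Real.exp_mul]
    congr 1
    field_simp
  simp_rw [hF', hG', one_div, inv_inv] at hH
  have hgexp : AEStronglyMeasurable (fun y => Real.exp (g y)) μ :=
    (Real.continuous_exp.measurable.comp hgm).aestronglyMeasurable
  have hinv : ∫ x, Real.exp (g (T x)) ∂μ = ∫ x, Real.exp (g x) ∂μ := by
    have h1 := integral_map (f := fun y => Real.exp (g y)) hT.measurable.aemeasurable
      (by rw [hT.map_eq]; exact hgexp)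
    rw [hT.map_eq] at h1
    exact h1.symm
  rw [hinv] at hH
  exact hH

end Abstract

/-! ## Part B — the whole Hellinger deviation of a one-body law is below its conditional entropy -/

section OneBody

/-- (skeleton, verbatim) The locally-Maxwellian reference of a one-body law. -/
def condRef (π : Measure (T3 × V3)) : Measure (T3 × V3) :=
  π.fst.prod (stdGaussian V3)

/-- (skeleton, verbatim) Conditional velocity entropy `KL(π ‖ πˣ ⊗ γ)`. -/
def condKL (π : Measure (T3 × V3)) : ℝ≥0∞ :=
  klDiv π (condRef π)

/-- (skeleton, verbatim) The Hellinger variable `u = √r − 1`, `r = dπ/d(πˣ ⊗ γ)`. -/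
def hellingerDev (π : Measure (T3 × V3)) (p : T3 × V3) : ℝ :=
  Real.sqrt ((π.rnDeriv (condRef π) p).toReal) - 1

/-- (skeleton, verbatim) Fast defect of a velocity function. -/
def fastDefect (w : V3 → ℝ) : ℝ≥0∞ :=
  ⨅ q : ℝ × V3 × ℝ,
    ∫⁻ v, ENNReal.ofReal ((w v - (q.1 + inner ℝ q.2.1 v + q.2.2 * ‖v‖ ^ 2)) ^ 2) ∂(stdGaussian V3)

/-- (skeleton, verbatim) Fast deviation of a one-body law. -/
def fastDev (π : Measure (T3 × V3)) : ℝ≥0∞ :=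
  ∫⁻ x, fastDefect (fun v => hellingerDev π (x, v)) ∂π.fst

/-- The pointwise identity behind "Hellinger ≤ KL": `klFun r − (√r − 1)² = 2√r · klFun(√r)` (`r ≥ 0`). -/
theorem klFun_sub_sq_sqrt_sub_one {r : ℝ} (hr : 0 ≤ r) :
    klFun r - (Real.sqrt r - 1) ^ 2 = 2 * Real.sqrt r * klFun (Real.sqrt r) := by
  have hs0 : 0 ≤ Real.sqrt r := Real.sqrt_nonneg r
  have hr' : r = Real.sqrt r ^ 2 := (Real.sq_sqrt hr).symm
  set s := Real.sqrt r with hs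
  rw [hr', klFun_apply, klFun_apply, Real.log_pow, Nat.cast_ofNat]
  ring

/-- `(√r − 1)² ≤ r log r + 1 − r` for `r ≥ 0` (squared Hellinger integrand below the KL integrand, pointwise). -/
theorem sq_sqrt_sub_one_le_klFun {r : ℝ} (hr : 0 ≤ r) : (Real.sqrt r - 1) ^ 2 ≤ klFun r := by
  have h := klFun_sub_sq_sqrt_sub_one hr
  have h2 : 0 ≤ 2 * Real.sqrt r * klFun (Real.sqrt r) :=
    mul_nonneg (mul_nonneg (by norm_num) (Real.sqrt_nonneg r)) (klFun_nonneg (Real.sqrt_nonneg r))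
  linarith

/-- The fast defect is at most the full `L²(γ)` norm (take the quadratic weight `0`). -/
theorem fastDefect_le_lintegral_sq (w : V3 → ℝ) :
    fastDefect w ≤ ∫⁻ v, ENNReal.ofReal ((w v) ^ 2) ∂(stdGaussian V3) := by
  refine (iInf_le _ ((0 : ℝ), (0 : V3), (0 : ℝ))).trans (le_of_eq ?_)
  refine lintegral_congr fun v => ?_
  simp

/-- **Part B.** For every finite one-body law `π` on `𝕋³ × ℝ³`: `fastDev π ≤ condKL π` — the WHOLE Hellinger
deviation `∫‖√r − 1‖²_{L²(γ)} dπˣ` (not only its fast-sector part) is below the conditional velocity entropy. -/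
theorem fastDev_le_condKL (π : Measure (T3 × V3)) [IsFiniteMeasure π] : fastDev π ≤ condKL π := by
  unfold fastDev condKL
  by_cases hac : π ≪ condRef π
  swap
  · rw [klDiv_of_not_ac hac]; exact le_top
  haveI : IsFiniteMeasure (condRef π) := by unfold condRef; infer_instance
  rw [klDiv_eq_lintegral_klFun_of_ac hac]
  have hmeas : Measurable fun p : T3 × V3 => ENNReal.ofReal (klFun ((π.rnDeriv (condRef π) p).toReal)) :=
    (measurable_klFun.comp (Measure.measurable_rnDeriv _ _).ennreal_toReal).ennreal_ofReal
  have hprod : ∫⁻ p, ENNReal.ofReal (klFun ((π.rnDeriv (condRef π) p).toReal)) ∂(condRef π) =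
      ∫⁻ x, ∫⁻ v, ENNReal.ofReal (klFun ((π.rnDeriv (condRef π) (x, v)).toReal)) ∂(stdGaussian V3) ∂π.fst := by
    show ∫⁻ p, ENNReal.ofReal (klFun ((π.rnDeriv (condRef π) p).toReal)) ∂(π.fst.prod (stdGaussian V3)) = _
    exact lintegral_prod _ hmeas.aemeasurable
  rw [hprod]
  refine lintegral_mono fun x => ?_
  refine (fastDefect_le_lintegral_sq _).trans ?_
  refine lintegral_mono fun v => ?_
  unfold hellingerDev
  exact ENNReal.ofReal_le_ofReal (sq_sqrt_sub_one_le_klFun ENNReal.toReal_nonneg)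

end OneBody


/-! ## Part C — crux frame: `OneBodyEntropyBudget → DiscreteWindowPressureDecay → FastSectorDominance` -/

section Frame

/-- (skeleton, verbatim) Hard-sphere flows of `N + 1` spheres of reduced diameter `σ` on `𝕋³`. -/
abbrev Flow (σ : ℝ) (N : ℕ) : Type :=
  HardSphereFlow (Literature.Analysis.FluidPDE.Torus.geometry (Fin 3)) (hsDiameter σ N) (N + 1)

/-- (skeleton, verbatim) Phase space of `N + 1` spheres on `𝕋³`. -/
abbrev Phase (N : ℕ) : Type := Config (N + 1) (Fin 3) T3

/-- (skeleton, verbatim) The flow-invariant global Gibbs law `G_N`. -/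
abbrev gibbs (σ a θ : ℝ) (u₀ : V3) (N : ℕ) (Φ : Flow σ N) : Measure (Phase N) :=
  localGibbsLaw σ (fun _ => a) (fun _ => u₀) (fun _ => θ) N Φ

/-- (skeleton, verbatim) `ℓ_N = (N+1)^{-1/3}`. -/
abbrev scale (N : ℕ) : ℝ := ((N + 1 : ℕ) : ℝ) ^ (-(1 / 3 : ℝ))

/-- (skeleton, verbatim) Standardised velocity. -/
abbrev stdVel (θ : ℝ) (u₀ : V3) (w : V3) : V3 := (Real.sqrt θ)⁻¹ • (w - u₀)

/-- (skeleton, verbatim) The fast one-body observable `F`. -/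
abbrev fluxObs (θ : ℝ) (u₀ : V3) (φ : T3 → ℝ) (g : V3 → ℝ) (N : ℕ) (z : Phase N) : ℝ :=
  ∑ i, φ (z i).1 * g ((Real.sqrt θ)⁻¹ • ((z i).2 - u₀))

/-- (skeleton, verbatim) Discrete window average. -/
def discAvg {σ : ℝ} {N : ℕ} (Φ : Flow σ N) (F : Phase N → ℝ) (n : ℕ) (lag : ℝ) (z : Phase N) : ℝ :=
  (n : ℝ)⁻¹ * ∑ j : Fin n, F (Φ.flow ((((j : ℕ) : ℝ) + 1) * lag) z)

/-- (skeleton, verbatim) The window optimiser `Q = G_N.tilted(2A)`. -/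
def optimiser (σ a θ : ℝ) (u₀ : V3) (N : ℕ) (Φ : Flow σ N) (φ : T3 → ℝ) (g : V3 → ℝ) (n : ℕ) (lag : ℝ) :
    Measure (Phase N) :=
  (gibbs σ a θ u₀ N Φ).tilted (fun z => 2 * discAvg Φ (fluxObs θ u₀ φ g N) n lag z)

/-- (skeleton, verbatim) Position and standardised velocity of particle `i` at time `t`. -/
def oneBodyObs (θ : ℝ) (u₀ : V3) {σ : ℝ} {N : ℕ} (Φ : Flow σ N) (t : ℝ) (i : Fin (N + 1)) (z : Phase N) :
    T3 × V3 :=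
  ((Φ.flow t z i).1, stdVel θ u₀ (Φ.flow t z i).2)

/-- (skeleton, verbatim) The symmetrised window-averaged one-body law `Π̄`. -/
def windowOneBodyLaw (θ : ℝ) (u₀ : V3) {σ : ℝ} {N : ℕ} (Φ : Flow σ N) (P : Measure (Phase N)) (n : ℕ)
    (lag : ℝ) : Measure (T3 × V3) :=
  ((((N + 1 : ℕ) : ℝ≥0∞))⁻¹ * ((n : ℝ≥0∞))⁻¹) •
    ∑ i : Fin (N + 1), ∑ j : Fin n, P.map (oneBodyObs θ u₀ Φ ((((j : ℕ) : ℝ) + 1) * lag) i)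

/-- (skeleton, verbatim) Statement of stub 2. -/
def OneBodyEntropyBudget : Prop :=
  ∀ (σ a θ : ℝ) (u₀ : V3), 0 < σ → σ ≤ 1 / 2 → 0 < a → 0 < θ →
    ∀ (N : ℕ) (Φ : Flow σ N) (n : ℕ) (lag : ℝ), 1 ≤ n →
      ∀ P : Measure (Phase N), IsProbabilityMeasure P →
        IsProbabilityMeasure (windowOneBodyLaw θ u₀ Φ P n lag) ∧
        ((N + 1 : ℕ) : ℝ≥0∞) * condKL (windowOneBodyLaw θ u₀ Φ P n lag) ≤ klDiv P (gibbs σ a θ u₀ N Φ)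

/-- (skeleton, verbatim) Statement of stub 4 (antecedent of stub 5). -/
def CollisionTransportIdentity : Prop :=
  ∀ (σ a θ : ℝ) (u₀ : V3), 0 < σ → σ ≤ 1 / 2 → 0 < a → 0 < θ →
    ∀ (N : ℕ) (Φ : Flow σ N) (P : Measure (Phase N)), IsProbabilityMeasure P → P ≪ gibbs σ a θ u₀ N Φ →
      ∀ T : ℝ, 0 ≤ T →
        Integrable (fun z => Φ.collisionSum (Set.Ioc 0 T) (fun _ => (1 : ℝ)) z) P →
        ∀ (i : Fin (N + 1)) (ψ : ℝ → T3 × V3 → ℝ),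
          Continuous (Function.uncurry ψ) → (∃ C : ℝ, ∀ t p, |ψ t p| ≤ C) →
          (∀ p, Differentiable ℝ (fun t => ψ t p)) →
          Continuous (Function.uncurry fun t p => deriv (fun s => ψ s p) t) →
          (∃ C : ℝ, ∀ t p, |deriv (fun s => ψ s p) t| ≤ C) →
          (∫ z, ψ T ((z i).1, stdVel θ u₀ (Φ.flow T z i).2) ∂P) -
              ∫ z, ψ 0 ((z i).1, stdVel θ u₀ (Φ.flow 0 z i).2) ∂P =
            (∫ z, Φ.collisionSum (Set.Ioc 0 T)
                (fun c => if c.fst = i then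
                    ψ c.time ((z i).1, stdVel θ u₀ c.postVel.1) - ψ c.time ((z i).1, stdVel θ u₀ c.preVel.1)
                  else 0) z ∂P) +
              ∫ z, (∫ t in (0 : ℝ)..T, deriv (fun s => ψ s ((z i).1, stdVel θ u₀ (Φ.flow t z i).2)) t) ∂P

/-- (skeleton, verbatim) Statement of stub 5, `stub_fastSectorDominance`. -/
def FastSectorDominance : Prop :=
  CollisionTransportIdentity →
  ∀ (a θ : ℝ) (u₀ : V3), 0 < a → 0 < θ → ∃ σ₀ : ℝ, 0 < σ₀ ∧ ∀ σ : ℝ, 0 < σ → σ < σ₀ →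
    ∃ κ₁ : ℝ, 0 < κ₁ ∧ ∃ A : ℝ, 0 ≤ A ∧ ∃ C : ℝ, 0 ≤ C ∧
      ∀ (φ : T3 → ℝ) (g : V3 → ℝ), Continuous φ → Continuous g → (∀ x, |φ x| ≤ 1) → (∀ v, |g v| ≤ κ₁) →
        (∀ (c₀ c₂ : ℝ) (b : V3),
          ∫ v, g v * (c₀ + inner ℝ b v + c₂ * ‖v‖ ^ 2) ∂(stdGaussian V3) = 0) →
        ∀ η : ℝ, 0 < η → ∃ H₁ : ℝ, 0 < H₁ ∧ ∀ H : ℝ, H₁ ≤ H →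
          ∃ N₀ : ℕ, ∀ N : ℕ, N₀ ≤ N → ∀ Φ : Flow σ N, ∃ n : ℕ, 1 ≤ n ∧
            ((N : ℝ) + 1) *
                (fastDev (windowOneBodyLaw θ u₀ Φ
                  (optimiser σ a θ u₀ N Φ φ g n (H * scale N / n)) n (H * scale N / n))).toReal ≤
              C * (klDiv (optimiser σ a θ u₀ N Φ φ g n (H * scale N / n)) (gibbs σ a θ u₀ N Φ)).toReal / H +
                A * (klDiv (optimiser σ a θ u₀ N Φ φ g n (H * scale N / n)) (gibbs σ a θ u₀ N Φ)).toReal ^ 2 /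
                  ((N : ℝ) + 1) +
                η * ((N : ℝ) + 1)

/-- **The middle of the sandwich.** DISCRETE-WINDOW PRESSURE DECAY at amplitude `κ₂`: for all admissible `φ, g`
(`|g| ≤ κ₂`), every `η > 0`, all windows `H ≥ H₁(φ,g,η)`, all `N ≥ N₀`, every flow and all samplings `n ≥ n₀`,
`∫ exp(2·A_n) dG_N ≤ e^{η(N+1)}` (`A_n` the discrete average over the sample times `k·Hℓ_N/n`, `k = 1..n`). This is the
shared wall `KineticFluxLdDecay` (stmt-10967) in discrete-sampling form: 10967 ⇒ it by Hölder-subadditivity of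
`L ↦ L·log∫e^{Ā_L}dG_N` (upgrading `∃τ` to `∀H ≥ H₁ := max(τ, κτ/η)`) and convergence of right-endpoint Riemann sums
of the piecewise-continuous path `t ↦ F(Φ_t z)` on the good set (bounded convergence; `n₀ = n₀(N, Φ, H)`). -/
def DiscreteWindowPressureDecay : Prop :=
  ∀ (a θ : ℝ) (u₀ : V3), 0 < a → 0 < θ → ∃ σ₀ : ℝ, 0 < σ₀ ∧ ∀ σ : ℝ, 0 < σ → σ < σ₀ →
    ∃ κ₂ : ℝ, 0 < κ₂ ∧
      ∀ (φ : T3 → ℝ) (g : V3 → ℝ), Continuous φ → Continuous g → (∀ x, |φ x| ≤ 1) → (∀ v, |g v| ≤ κ₂) →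
        (∀ (c₀ c₂ : ℝ) (b : V3),
          ∫ v, g v * (c₀ + inner ℝ b v + c₂ * ‖v‖ ^ 2) ∂(stdGaussian V3) = 0) →
        ∀ η : ℝ, 0 < η → ∃ H₁ : ℝ, 0 < H₁ ∧ ∀ H : ℝ, H₁ ≤ H →
          ∃ N₀ : ℕ, ∀ N : ℕ, N₀ ≤ N → ∀ Φ : Flow σ N, ∃ n₀ : ℕ, 1 ≤ n₀ ∧ ∀ n : ℕ, n₀ ≤ n →
            ∫ z, Real.exp (2 * discAvg Φ (fluxObs θ u₀ φ g N) n (H * scale N / n) z) ∂(gibbs σ a θ u₀ N Φ) ≤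
              Real.exp (η * ((N : ℝ) + 1))

/-- Measurability of the crux's one-body observable (continuity; `Config` over the torus is a Borel space). -/
theorem measurable_fluxObs {θ : ℝ} {u₀ : V3} {φ : T3 → ℝ} {g : V3 → ℝ} (hφ : Continuous φ)
    (hg : Continuous g) (N : ℕ) : Measurable (fluxObs θ u₀ φ g N) := by
  refine Continuous.measurable ?_
  unfold fluxObs
  fun_prop

/-- `|F| ≤ (N+1)κ`. -/
theorem abs_fluxObs_le {θ κ : ℝ} {u₀ : V3} {φ : T3 → ℝ} {g : V3 → ℝ} (hφ1 : ∀ x, |φ x| ≤ 1)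
    (hgκ : ∀ v, |g v| ≤ κ) (N : ℕ) (z : Phase N) : |fluxObs θ u₀ φ g N z| ≤ (N + 1) * κ := by
  calc |fluxObs θ u₀ φ g N z|
      ≤ ∑ i, |φ (z i).1 * g ((Real.sqrt θ)⁻¹ • ((z i).2 - u₀))| := Finset.abs_sum_le_sum_abs _ _
    _ ≤ ∑ _i : Fin (N + 1), κ := by
        refine Finset.sum_le_sum fun i _ => ?_
        rw [abs_mul]
        calc |φ (z i).1| * |g ((Real.sqrt θ)⁻¹ • ((z i).2 - u₀))|
            ≤ 1 * κ := mul_le_mul (hφ1 _) (hgκ _) (abs_nonneg _) zero_le_one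
          _ = κ := one_mul κ
    _ = (N + 1) * κ := by simp

/-- The discrete window average of a measurable observable is measurable (each `Φ.flow t` is measurable). -/
theorem measurable_discAvg {σ : ℝ} {N : ℕ} (Φ : Flow σ N) {F : Phase N → ℝ} (hF : Measurable F) (n : ℕ)
    (lag : ℝ) : Measurable (discAvg Φ F n lag) := by
  unfold discAvg
  refine Measurable.const_mul ?_ _
  refine Finset.measurable_sum _ fun j _ => ?_
  exact hF.comp (Φ.measurable_flow _)

/-- The discrete window average inherits the sup bound of the observable. -/
theorem abs_discAvg_le {σ : ℝ} {N : ℕ} (Φ : Flow σ N) {F : Phase N → ℝ} {B : ℝ} (hB : ∀ z, |F z| ≤ B)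
    {n : ℕ} (hn : 1 ≤ n) (lag : ℝ) (z : Phase N) : |discAvg Φ F n lag z| ≤ B := by
  have hn0 : (n : ℝ) ≠ 0 := Nat.cast_ne_zero.2 (by omega)
  have hnpos : 0 < (n : ℝ) := by exact_mod_cast hn
  unfold discAvg
  rw [abs_mul, abs_inv, Nat.abs_cast]
  calc (n : ℝ)⁻¹ * |∑ j : Fin n, F (Φ.flow ((((j : ℕ) : ℝ) + 1) * lag) z)|
      ≤ (n : ℝ)⁻¹ * ∑ _j : Fin n, B := by
        refine mul_le_mul_of_nonneg_left ?_ (inv_nonneg.2 hnpos.le)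
        exact (Finset.abs_sum_le_sum_abs _ _).trans (Finset.sum_le_sum fun j _ => hB _)
    _ = B := by
        rw [Finset.sum_const, Finset.card_univ, Fintype.card_fin, nsmul_eq_mul, ← mul_assoc,
          inv_mul_cancel₀ hn0, one_mul]

/-- Scaling the velocity test scales the observable. -/
theorem fluxObs_const_mul (θ : ℝ) (u₀ : V3) (φ : T3 → ℝ) (g : V3 → ℝ) (c : ℝ) (N : ℕ) (z : Phase N) :
    fluxObs θ u₀ φ (fun v => c * g v) N z = c * fluxObs θ u₀ φ g N z := by
  simp only [fluxObs, Finset.mul_sum]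
  exact Finset.sum_congr rfl fun i _ => by ring

/-- Scaling the velocity test scales the discrete window average. -/
theorem discAvg_fluxObs_const_mul {σ : ℝ} {N : ℕ} (Φ : Flow σ N) (θ : ℝ) (u₀ : V3) (φ : T3 → ℝ) (g : V3 → ℝ)
    (c : ℝ) (n : ℕ) (lag : ℝ) (z : Phase N) :
    discAvg Φ (fluxObs θ u₀ φ (fun v => c * g v) N) n lag z = c * discAvg Φ (fluxObs θ u₀ φ g N) n lag z := by
  simp only [discAvg, fluxObs_const_mul, ← Finset.mul_sum]
  ring

/-- Scaling the velocity test preserves the orthogonality clause. -/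
theorem orth_const_mul {g : V3 → ℝ}
    (horth : ∀ (c₀ c₂ : ℝ) (b : V3), ∫ v, g v * (c₀ + inner ℝ b v + c₂ * ‖v‖ ^ 2) ∂(stdGaussian V3) = 0)
    (c : ℝ) :
    ∀ (c₀ c₂ : ℝ) (b : V3), ∫ v, (c * g v) * (c₀ + inner ℝ b v + c₂ * ‖v‖ ^ 2) ∂(stdGaussian V3) = 0 := by
  intro c₀ c₂ b
  have h : (fun v => (c * g v) * (c₀ + inner ℝ b v + c₂ * ‖v‖ ^ 2)) =
      fun v => c * (g v * (c₀ + inner ℝ b v + c₂ * ‖v‖ ^ 2)) := by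
    funext v; ring
  rw [h, integral_const_mul, horth, mul_zero]

/-- **THE SANDWICH (upper slice).** Stub 2 and discrete-window pressure decay at amplitude `κ₂` imply
`stub_fastSectorDominance` at amplitude `κ₂/2` with `A = C = 0`: for the window optimiser `Q`,
`(N+1)·fd(Π̄(Q)) ≤ (N+1)·condKL(Π̄(Q)) ≤ KL(Q‖G_N) ≤ log∫e^{4A_n}dG_N + 2log∫e^{−2A_n}dG_N ≤ η(N+1)` — Part B, stub 2,
Part A, and the hypothesis applied to the admissible observables `2g` and `−g`. No kinetic input is used. -/
theorem fastSectorDominance_of_discreteWindowPressureDecay (h₂ : OneBodyEntropyBudget)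
    (hP : DiscreteWindowPressureDecay) : FastSectorDominance := by
  intro _h₄ a θ u₀ ha hθ
  obtain ⟨σ₀, hσ₀, HP⟩ := hP a θ u₀ ha hθ
  refine ⟨min σ₀ (1 / 2), lt_min hσ₀ (by norm_num), fun σ hσ hσlt => ?_⟩
  have hσ₀' : σ < σ₀ := lt_of_lt_of_le hσlt (min_le_left _ _)
  have hσhalf : σ ≤ 1 / 2 := (lt_of_lt_of_le hσlt (min_le_right _ _)).le
  obtain ⟨κ₂, hκ₂, Hφ⟩ := HP σ hσ hσ₀'
  refine ⟨κ₂ / 2, half_pos hκ₂, 0, le_rfl, 0, le_rfl, fun φ g hφ hg hφ1 hgκ horth η hη => ?_⟩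
  -- the two auxiliary admissible observables `2g` and `−g`
  have hgPc : Continuous fun v => 2 * g v := continuous_const.mul hg
  have hgMc : Continuous fun v => (-1) * g v := continuous_const.mul hg
  have hgPb : ∀ v, |2 * g v| ≤ κ₂ := fun v => by
    rw [abs_mul, abs_of_pos (by norm_num : (0 : ℝ) < 2)]
    linarith [hgκ v]
  have hgMb : ∀ v, |(-1) * g v| ≤ κ₂ := fun v => by
    rw [neg_one_mul, abs_neg]
    linarith [hgκ v, abs_nonneg (g v)]
  have hη3 : 0 < η / 3 := by positivity
  obtain ⟨HP, hHP, PP⟩ := Hφ φ (fun v => 2 * g v) hφ hgPc hφ1 hgPb (orth_const_mul horth 2) (η / 3) hη3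
  obtain ⟨HM, hHM, PM⟩ := Hφ φ (fun v => (-1) * g v) hφ hgMc hφ1 hgMb (orth_const_mul horth (-1)) (η / 3) hη3
  refine ⟨max HP HM, lt_max_of_lt_left hHP, fun H hH => ?_⟩
  obtain ⟨NP, QP⟩ := PP H ((le_max_left _ _).trans hH)
  obtain ⟨NM, QM⟩ := PM H ((le_max_right _ _).trans hH)
  refine ⟨max NP NM, fun N hN Φ => ?_⟩
  obtain ⟨nP, hnP, RP⟩ := QP N ((le_max_left _ _).trans hN) Φ
  obtain ⟨nM, hnM, RM⟩ := QM N ((le_max_right _ _).trans hN) Φ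
  have hn : 1 ≤ max nP nM := hnP.trans (le_max_left _ _)
  refine ⟨max nP nM, hn, ?_⟩
  have ZP := RP (max nP nM) (le_max_left _ _)
  have ZM := RM (max nP nM) (le_max_right _ _)
  -- frame objects
  set n : ℕ := max nP nM with hndef
  set lag : ℝ := H * scale N / n with hlagdef
  set G : Measure (Phase N) := gibbs σ a θ u₀ N Φ with hGdef
  haveI hGprob : IsProbabilityMeasure G :=
    Literature.MathematicalPhysics.KineticTheory.isProbabilityMeasure_localGibbsLaw
      continuous_const continuous_const continuous_const (fun _ => ha) (fun _ => hθ) hσhalf N Φ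
  set V : Phase N → ℝ := fun z => 2 * discAvg Φ (fluxObs θ u₀ φ g N) n lag z with hVdef
  have hFm : Measurable (fluxObs θ u₀ φ g N) := measurable_fluxObs hφ hg N
  have hVm : Measurable V := (measurable_discAvg Φ hFm n lag).const_mul 2
  have hFb : ∀ z, |fluxObs θ u₀ φ g N z| ≤ (N + 1) * (κ₂ / 2) := abs_fluxObs_le hφ1 hgκ N
  have hVb : ∀ z, |V z| ≤ 2 * ((N + 1) * (κ₂ / 2)) := fun z => by
    rw [hVdef, abs_mul, abs_of_pos (by norm_num : (0 : ℝ) < 2)]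
    exact mul_le_mul_of_nonneg_left (abs_discAvg_le Φ hFb hn lag z) (by norm_num)
  -- the two pressures control `2V` and `−V`
  have hP : ∀ z, 2 * discAvg Φ (fluxObs θ u₀ φ (fun v => 2 * g v) N) n lag z = 2 * V z := fun z => by
    rw [discAvg_fluxObs_const_mul, hVdef]
  have hM : ∀ z, 2 * discAvg Φ (fluxObs θ u₀ φ (fun v => (-1) * g v) N) n lag z = -V z := fun z => by
    rw [discAvg_fluxObs_const_mul, hVdef]; ring
  simp_rw [hP] at ZP
  simp_rw [hM] at ZM
  have h2Vb : ∀ z, |2 * V z| ≤ 2 * (2 * ((N + 1) * (κ₂ / 2))) := fun z => by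
    rw [abs_mul, abs_of_pos (by norm_num : (0 : ℝ) < 2)]
    exact mul_le_mul_of_nonneg_left (hVb z) (by norm_num)
  have hnVb : ∀ z, |(-V z)| ≤ 2 * ((N + 1) * (κ₂ / 2)) := fun z => by rw [abs_neg]; exact hVb z
  have hVnm : Measurable fun z => -V z := hVm.neg
  have hIP : 0 < ∫ z, Real.exp (2 * V z) ∂G := integral_exp_pos (integrable_exp_of_abs_le (hVm.const_mul 2) h2Vb)
  have hIM : 0 < ∫ z, Real.exp (-V z) ∂G := integral_exp_pos (integrable_exp_of_abs_le hVnm hnVb)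
  have lP : Real.log (∫ z, Real.exp (2 * V z) ∂G) ≤ η / 3 * ((N : ℝ) + 1) := (Real.log_le_iff_le_exp hIP).2 ZP
  have lM : Real.log (∫ z, Real.exp (-V z) ∂G) ≤ η / 3 * ((N : ℝ) + 1) := (Real.log_le_iff_le_exp hIM).2 ZM
  -- entropy of the optimiser
  have hQ : optimiser σ a θ u₀ N Φ φ g n lag = G.tilted V := rfl
  have hK : (klDiv (G.tilted V) G).toReal ≤ η * ((N : ℝ) + 1) := by
    have := toReal_klDiv_tilted_le (μ := G) hVm hVb
    linarith
  have hKfin : klDiv (G.tilted V) G ≠ ∞ := klDiv_tilted_ne_top hVm hVb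
  -- one-body law of the optimiser: Part B + stub 2
  have hQprob : IsProbabilityMeasure (G.tilted V) := isProbabilityMeasure_tilted (integrable_exp_of_abs_le hVm hVb)
  obtain ⟨hLawprob, hbudget⟩ := h₂ σ a θ u₀ hσ hσhalf ha hθ N Φ n lag hn (G.tilted V) hQprob
  haveI := hLawprob
  set Law := windowOneBodyLaw θ u₀ Φ (G.tilted V) n lag with hLawdef
  have hchain : ((N + 1 : ℕ) : ℝ≥0∞) * fastDev Law ≤ klDiv (G.tilted V) G :=
    (mul_le_mul' le_rfl (fastDev_le_condKL Law)).trans hbudget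
  have hreal : ((N : ℝ) + 1) * (fastDev Law).toReal ≤ (klDiv (G.tilted V) G).toReal := by
    have h1 := ENNReal.toReal_mono hKfin hchain
    rw [ENNReal.toReal_mul] at h1
    have h2 : (((N + 1 : ℕ) : ℝ≥0∞)).toReal = (N : ℝ) + 1 := by
      rw [ENNReal.toReal_natCast, Nat.cast_add, Nat.cast_one]
    rw [h2] at h1
    exact h1
  rw [hQ]
  have hfin : ((N : ℝ) + 1) * (fastDev Law).toReal ≤ η * ((N : ℝ) + 1) := hreal.trans hK
  simpa using hfin


/-- **Suggested repair of the open stub (drefute g2).** `FastSectorDominance` with the slack quantifier moved AFTER the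
window: `∃ H₁ ∀ H ≥ H₁ ∀ η > 0 ∃ N₀ …` instead of `∀ η > 0 ∃ H₁ ∀ H ≥ H₁ ∃ N₀ …` (all other tokens verbatim). The `η(N+1)`
slack then only absorbs `N → ∞` corrections at FIXED `H` (transport `O(ℓ_N∇φ)`), and the content of the statement is the
RATE `(N+1)·fd ≤ C·K/H (+ A·K²/(N+1))` at fixed amplitude — the linear-response prediction `fd ≍ κ²t_rel²/(Hℓ_N)²`,
`k ≍ κ²t_rel/(Hℓ_N)`, `C ≍ (λσ²√θ)⁻¹` —, which is NOT a consequence of the crux (the sandwich needs `H ≥ H₁(η)`), while it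
still implies the registered stub (`fastSectorDominance_of_rate`) and hence the crux through the skeleton's composition. -/
def FastSectorDominanceRate : Prop :=
  CollisionTransportIdentity →
  ∀ (a θ : ℝ) (u₀ : V3), 0 < a → 0 < θ → ∃ σ₀ : ℝ, 0 < σ₀ ∧ ∀ σ : ℝ, 0 < σ → σ < σ₀ →
    ∃ κ₁ : ℝ, 0 < κ₁ ∧ ∃ A : ℝ, 0 ≤ A ∧ ∃ C : ℝ, 0 ≤ C ∧
      ∀ (φ : T3 → ℝ) (g : V3 → ℝ), Continuous φ → Continuous g → (∀ x, |φ x| ≤ 1) → (∀ v, |g v| ≤ κ₁) →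
        (∀ (c₀ c₂ : ℝ) (b : V3),
          ∫ v, g v * (c₀ + inner ℝ b v + c₂ * ‖v‖ ^ 2) ∂(stdGaussian V3) = 0) →
        ∃ H₁ : ℝ, 0 < H₁ ∧ ∀ H : ℝ, H₁ ≤ H → ∀ η : ℝ, 0 < η →
          ∃ N₀ : ℕ, ∀ N : ℕ, N₀ ≤ N → ∀ Φ : Flow σ N, ∃ n : ℕ, 1 ≤ n ∧
            ((N : ℝ) + 1) *
                (fastDev (windowOneBodyLaw θ u₀ Φ
                  (optimiser σ a θ u₀ N Φ φ g n (H * scale N / n)) n (H * scale N / n))).toReal ≤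
              C * (klDiv (optimiser σ a θ u₀ N Φ φ g n (H * scale N / n)) (gibbs σ a θ u₀ N Φ)).toReal / H +
                A * (klDiv (optimiser σ a θ u₀ N Φ φ g n (H * scale N / n)) (gibbs σ a θ u₀ N Φ)).toReal ^ 2 /
                  ((N : ℝ) + 1) +
                η * ((N : ℝ) + 1)

/-- The repaired (rate) form implies the registered stub: pure quantifier logic (`H₁` independent of `η`). -/
theorem fastSectorDominance_of_rate (h : FastSectorDominanceRate) : FastSectorDominance := by
  intro h₄ a θ u₀ ha hθ
  obtain ⟨σ₀, hσ₀, Hσ⟩ := h h₄ a θ u₀ ha hθ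
  refine ⟨σ₀, hσ₀, fun σ hσ hσlt => ?_⟩
  obtain ⟨κ₁, hκ₁, A, hA, C, hC, Hφ⟩ := Hσ σ hσ hσlt
  refine ⟨κ₁, hκ₁, A, hA, C, hC, fun φ g hφ hg hφ1 hgκ horth η hη => ?_⟩
  obtain ⟨H₁, hH₁, HH⟩ := Hφ φ g hφ hg hφ1 hgκ horth
  exact ⟨H₁, hH₁, fun H hH => HH H hH η hη⟩

end Frame

end Summit.AtomisticToContinuum.HydrodynamicLimit.Cruxes.CorrectorPressureDecay.KineticEntropyCollisionBudget.Sandwich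

end
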